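import Summits.BirchSwinnertonDyer.BirchSwinnertonDyer.Theorems.AlignedTransportAtTwoMainConjectureTransportAlignedAtTwoKilfordStratumShared
import HarnessLib

/-!
# Route `AlignedTransportAtTwo`, crux C1 `MainConjectureTransportAlignedAtTwo` (stmt-BirchSwinnertonDyer-22296), line `birth`:
# the Kilford-stratum dictionary on the whole HEIGHT-ONE locus at `2` (good ordinary OR multiplicative)

Cell `bsd-f1-sign2`, WIDTH-5 attach seat `bsd-line-att-p4` g11 (`--supports stmt-BirchSwinnertonDyer-22296`). THEOREMS ONLY (no `def`, no
named fact, no `sorry`). Companion of `…KilfordStratum` / `…KilfordStratumShared`. BSD is not proved by this; C1 is not closed by this.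

The route's line-transfer statements `F1Sign2.AnalyticLineTransferAtTwo{,OnStratum,OffStratum}` live on the HEIGHT-ONE locus at `2`
(`IsEvenBranchLiftAtTwo`: good ordinary OR multiplicative reduction at `2`), while crux C1 is its good-ordinary part. The one-curve
dictionary «ON the Kilford stratum ⟺ `Δ ∈ ℚ₂²`» of `…KilfordStratum` §3 used ordinarity only through «`b₂` is odd» (Hensel's simple root
`ū = 1` of `ū²(ū + 1)`); on the minimal equation of a curve with MULTIPLICATIVE reduction at `2`, `a₁` is odd as well (tree
`odd_a₁_of_hasMultiplicativeReductionAtPrime_two`: `a₁` even forces `16 ∣ c₄`), so the whole dictionary extends verbatim: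

* §1 `exists_padicInt_root_of_odd_b₂` — the Hensel root under the bare hypothesis `Odd b₂` (same proof as the ordinary case);
  `odd_b₂_of_hasMultiplicativeReductionAtPrime_two`, `exists_padicInt_root_of_hasMultiplicativeReductionAtPrime_two`.
* §2 `onKilfordStratumAtTwo_iff_isSquare_padic_Δ_of_mult`, `not_onKilfordStratumAtTwo_iff_forall_sq_ne_of_mult` and the height-one forms
  `…_of_heightOne` (hypothesis `IsOrdinaryAt W 2 ∨ W.HasMultiplicativeReductionAtPrime 2`, the disjunction inside `IsEvenBranchLiftAtTwo`).
  (For multiplicative `2` the numeric reading is `Δ_min = 2^{v}·u`, `v = −ord₂ j ≥ 1`: square iff `v` even and `u ≡ 1 (mod 8)` — not spelled out.)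

References: Silverman AEC VII.5 Prop. 5.1, III.1 [SilvermanAEC2009]; Serre, Cours d'arithmétique II.3.3 [Serre1973]; Kilford–Wiese 2008
[KilfordWiese2008] (for `2 ∥ N` no printed multiplicity statement covers either side of the stratum — REF2 v7).
-/

set_option autoImplicit false
-- justification: the `Summit.BirchSwinnertonDyer.BirchSwinnertonDyer.…` path repeats a component (route-file convention)
set_option linter.dupNamespace false

noncomputable section

open scoped Classical

open Polynomial WeierstrassCurve NumberField
open Literature.NumberTheory.EllipticCurves Literature.NumberTheory.EllipticCurves.Greenberg1999
open Summit.BirchSwinnertonDyer.Rank1Residual.F1Sign2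
open Summit.BirchSwinnertonDyer.BirchSwinnertonDyer.Theorems.AlignedTransportAtTwoBridge
open Summit.BirchSwinnertonDyer.BirchSwinnertonDyer.Theorems.AlignedTransportAtTwoSharedCubicField
open Summit.BirchSwinnertonDyer.BirchSwinnertonDyer.Theorems.AlignedTransportAtTwoKilfordStratum

namespace Summit.BirchSwinnertonDyer.BirchSwinnertonDyer.Theorems.AlignedTransportAtTwoKilfordStratumHeightOne

/-! ## §1 The Hensel root from `b₂` odd; multiplicative reduction at `2` -/

section Hensel

variable (W : WeierstrassCurve ℚ) [W.IsGloballyMinimal]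

/-- **`b₂` odd ⇒ the `u`-cubic of the minimal equation has an ODD-UNIT root in `ℤ₂`** (Hensel's lemma on the simple root `ū = 1` of
`ū²(ū + 1)`; the proof of `…KilfordStratum.exists_padicInt_root_of_isOrdinaryAt_two` verbatim under the bare parity hypothesis).
[cite: SilvermanAEC2009, VII.2 and III.1] -/
theorem exists_padicInt_root_of_odd_b₂ (hb₂ : Odd (integralModelInt W).b₂) :
    ∃ e : ℤ_[2], ‖e‖ = 1 ∧ aeval (e : ℚ_[2]) (twoDivisionUCubic W) = 0 := by
  set M := integralModelInt W with hM
  set F : ℤ[X] := X ^ 3 + C M.b₂ * X ^ 2 + C (8 * M.b₄) * X + C (16 * M.b₆) with hF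
  have hFz : ∀ z : ℤ_[2], F.aeval z =
      z ^ 3 + (M.b₂ : ℤ_[2]) * z ^ 2 + ((8 * M.b₄ : ℤ) : ℤ_[2]) * z + ((16 * M.b₆ : ℤ) : ℤ_[2]) := by
    intro z
    simp only [hF, map_add, map_mul (aeval z), map_pow, aeval_X, aeval_C, algebraMap_int_eq, Int.coe_castRingHom]
  have hF1 : F.aeval (1 : ℤ_[2]) = ((1 + M.b₂ + 8 * M.b₄ + 16 * M.b₆ : ℤ) : ℤ_[2]) := by
    rw [hFz]; push_cast; ring
  have hdF : derivative F = C 3 * X ^ 2 + C (2 * M.b₂) * X + C (8 * M.b₄) := by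
    simp only [hF, derivative_add, derivative_mul, derivative_C, derivative_X_pow, derivative_X, zero_mul,
      zero_add, mul_one, map_mul]
    simp only [Nat.cast_ofNat, Nat.add_one_sub_one, pow_one]
    ring
  have hdF1 : (derivative F).aeval (1 : ℤ_[2]) = ((3 + 2 * M.b₂ + 8 * M.b₄ : ℤ) : ℤ_[2]) := by
    rw [hdF]
    simp only [map_add, map_mul (aeval (1 : ℤ_[2])), map_pow, aeval_X, aeval_C, algebraMap_int_eq,
      Int.coe_castRingHom]
    push_cast
    ring
  have hodd' : Odd (3 + 2 * M.b₂ + 8 * M.b₄) := by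
    have h1 : Even (2 * M.b₂ + 8 * M.b₄) := ⟨M.b₂ + 4 * M.b₄, by ring⟩
    have h3 : Odd (3 : ℤ) := ⟨1, by norm_num⟩
    simpa [add_assoc] using h3.add_even h1
  have heven' : Even (1 + M.b₂ + 8 * M.b₄ + 16 * M.b₆) := by
    have h2 : Even (8 * M.b₄ + 16 * M.b₆) := ⟨4 * M.b₄ + 8 * M.b₆, by ring⟩
    simpa [add_assoc] using (odd_one.add_odd hb₂).add h2
  have hn1 : ‖(derivative F).aeval (1 : ℤ_[2])‖ = 1 := by
    -- an odd integer is a `2`-adic unit (the tree's `PrintCf2.DyadicTorsion.norm_intCast_eq_one_of_odd`, three lines, not imported)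
    rw [hdF1, PadicInt.norm_intCast_eq_one_iff]
    obtain ⟨k, hk⟩ := hodd'
    exact ⟨1, -k, by rw [hk]; ring⟩
  have hnorm : ‖F.aeval (1 : ℤ_[2])‖ < ‖(derivative F).aeval (1 : ℤ_[2])‖ ^ 2 := by
    rw [hn1, one_pow, hF1]
    exact norm_intCast_padicInt_lt_one_of_even heven'
  obtain ⟨z, hz0, hz1, -, -⟩ := hensels_lemma hnorm
  rw [hn1] at hz1
  refine ⟨z, ?_, ?_⟩
  · -- `z = 1 + (z - 1)` with `‖z - 1‖ < 1 = ‖1‖`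
    have h := PadicInt.norm_add_eq_max_of_ne (q := (1 : ℤ_[2])) (r := z - 1) (by rw [norm_one]; exact hz1.ne')
    rw [add_sub_cancel, norm_one, max_eq_left hz1.le] at h
    exact h
  · have h := congrArg ((↑) : ℤ_[2] → ℚ_[2]) hz0
    rw [hFz] at h
    simp only [PadicInt.coe_add, PadicInt.coe_mul, PadicInt.coe_pow, PadicInt.coe_intCast, PadicInt.coe_zero] at h
    push_cast at h
    simp only [twoDivisionUCubic, map_add, map_mul, map_pow, aeval_X, aeval_C, eq_ratCast]
    rw [← ratCast_b₂_integralModelInt, ← ratCast_b₄_integralModelInt, ← ratCast_b₆_integralModelInt]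
    push_cast
    linear_combination h


variable [W.IsElliptic]

/-- **Multiplicative at `2` ⇒ `b₂` odd** (`b₂ = a₁² + 4a₂`, `a₁` odd on the minimal equation: tree
`odd_a₁_of_hasMultiplicativeReductionAtPrime_two`). [cite: SilvermanAEC2009, VII.5 Prop. 5.1] -/
theorem odd_b₂_of_hasMultiplicativeReductionAtPrime_two (hm : W.HasMultiplicativeReductionAtPrime 2) :
    Odd (integralModelInt W).b₂ := by
  have ha₁ := odd_a₁_of_hasMultiplicativeReductionAtPrime_two W hm
  have hb : (integralModelInt W).b₂ = (integralModelInt W).a₁ ^ 2 + 4 * (integralModelInt W).a₂ := rfl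
  have h4 : Even (4 * (integralModelInt W).a₂) := ⟨2 * (integralModelInt W).a₂, by ring⟩
  rw [hb]
  exact ha₁.pow.add_even h4

/-- **Multiplicative at `2` ⇒ odd-unit root of the `u`-cubic in `ℤ₂`.** [cite: SilvermanAEC2009, VII.5 Prop. 5.1 and VII.2] -/
theorem exists_padicInt_root_of_hasMultiplicativeReductionAtPrime_two (hm : W.HasMultiplicativeReductionAtPrime 2) :
    ∃ e : ℤ_[2], ‖e‖ = 1 ∧ aeval (e : ℚ_[2]) (twoDivisionUCubic W) = 0 :=
  exists_padicInt_root_of_odd_b₂ W (odd_b₂_of_hasMultiplicativeReductionAtPrime_two W hm)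

/-- **Height one at `2` ⇒ odd-unit root of the `u`-cubic in `ℤ₂`** (good ordinary: `…KilfordStratum`; multiplicative: above).
[cite: SilvermanAEC2009, VII.5 Prop. 5.1 and VII.2] -/
theorem exists_padicInt_root_of_heightOne (h : IsOrdinaryAt W 2 ∨ W.HasMultiplicativeReductionAtPrime 2) :
    ∃ e : ℤ_[2], ‖e‖ = 1 ∧ aeval (e : ℚ_[2]) (twoDivisionUCubic W) = 0 := by
  rcases h with h | h
  · exact exists_padicInt_root_of_isOrdinaryAt_two W h
  · exact exists_padicInt_root_of_hasMultiplicativeReductionAtPrime_two W h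

end Hensel

/-! ## §2 The dictionary on the height-one locus -/

section Dictionary

variable (W : WeierstrassCurve ℚ) [W.IsElliptic] [W.IsGloballyMinimal]

/-- **Multiplicative at `2`: ON the Kilford stratum ⟺ `Δ(W) ∈ ℚ₂²`.** [cite: SilvermanAEC2009, VII.5 Prop. 5.1 and III.1] -/
theorem onKilfordStratumAtTwo_iff_isSquare_padic_Δ_of_mult (hm : W.HasMultiplicativeReductionAtPrime 2) :
    OnKilfordStratumAtTwo W ↔ IsSquare (W.Δ : ℚ_[2]) := by
  refine ⟨isSquare_padic_Δ_of_onKilfordStratumAtTwo W, fun hsq ↦ ?_⟩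
  obtain ⟨e, -, he⟩ := exists_padicInt_root_of_hasMultiplicativeReductionAtPrime_two W hm
  exact splits_map_of_root_of_isSquare_ratCast_Δ W he hsq

/-- **Multiplicative at `2`, negated form**: `¬ OnKilfordStratumAtTwo W ↔ ∀ s : ℚ_[2], s ^ 2 ≠ Δ(W)`. [cite: SilvermanAEC2009, VII.5 Prop. 5.1 and III.1] -/
theorem not_onKilfordStratumAtTwo_iff_forall_sq_ne_of_mult (hm : W.HasMultiplicativeReductionAtPrime 2) :
    ¬ OnKilfordStratumAtTwo W ↔ ∀ s : ℚ_[2], s ^ 2 ≠ (W.Δ : ℚ_[2]) := by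
  rw [onKilfordStratumAtTwo_iff_isSquare_padic_Δ_of_mult W hm]
  constructor
  · intro h s hs
    exact h ⟨s, by rw [← hs, sq]⟩
  · rintro h ⟨r, hr⟩
    exact h r (by rw [hr, sq])

/-- **HEIGHT ONE at `2` (good ordinary OR multiplicative — the disjunction of `IsEvenBranchLiftAtTwo`): ON the Kilford stratum ⟺
`Δ(W) ∈ ℚ₂²`.** The dictionary on the whole domain of `F1Sign2.AnalyticLineTransferAtTwo{On,Off}Stratum`. [cite: SilvermanAEC2009, VII.5 Prop. 5.1 and III.1] -/
theorem onKilfordStratumAtTwo_iff_isSquare_padic_Δ_of_heightOne (h : IsOrdinaryAt W 2 ∨ W.HasMultiplicativeReductionAtPrime 2) :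
    OnKilfordStratumAtTwo W ↔ IsSquare (W.Δ : ℚ_[2]) := by
  rcases h with h | h
  · exact onKilfordStratumAtTwo_iff_isSquare_padic_Δ W h
  · exact onKilfordStratumAtTwo_iff_isSquare_padic_Δ_of_mult W h

/-- **HEIGHT ONE at `2`, negated form**: `¬ OnKilfordStratumAtTwo W ↔ ∀ s : ℚ_[2], s ^ 2 ≠ Δ(W)`. [cite: SilvermanAEC2009, VII.5 Prop. 5.1 and III.1] -/
theorem not_onKilfordStratumAtTwo_iff_forall_sq_ne_of_heightOne (h : IsOrdinaryAt W 2 ∨ W.HasMultiplicativeReductionAtPrime 2) :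
    ¬ OnKilfordStratumAtTwo W ↔ ∀ s : ℚ_[2], s ^ 2 ≠ (W.Δ : ℚ_[2]) := by
  rcases h with h | h
  · exact not_onKilfordStratumAtTwo_iff_forall_sq_ne W h
  · exact not_onKilfordStratumAtTwo_iff_forall_sq_ne_of_mult W h

/-- **OFF the stratum at height one the `ℚ₂`-roots of the `u`-cubic form a singleton `{e}`, `e ∈ ℤ₂ˣ`** (exactly one `ℚ₂`-rational
`2`-torsion point). [cite: SilvermanAEC2009, VII.5 Prop. 5.1 and III.1] -/
theorem exists_roots_map_eq_singleton_of_not_onKilfordStratumAtTwo_of_heightOne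
    (h : IsOrdinaryAt W 2 ∨ W.HasMultiplicativeReductionAtPrime 2) (hK : ¬ OnKilfordStratumAtTwo W) :
    ∃ e : ℤ_[2], ‖e‖ = 1 ∧ ((twoDivisionUCubic W).map (algebraMap ℚ ℚ_[2])).roots = {(e : ℚ_[2])} := by
  obtain ⟨e, he1, he⟩ := exists_padicInt_root_of_heightOne W h
  refine ⟨e, he1, ?_⟩
  have hfac := map_twoDivisionUCubic_eq_mul W he
  obtain ⟨hq2, hqm⟩ := natDegree_cofactor W (e : ℚ_[2])
  have hq0 := hqm.ne_zero
  have hprod0 : (X - C (e : ℚ_[2])) *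
      (X ^ 2 + C ((W.b₂ : ℚ_[2]) + e) * X + C ((e : ℚ_[2]) ^ 2 + (W.b₂ : ℚ_[2]) * e + 8 * (W.b₄ : ℚ_[2]))) ≠ 0 :=
    mul_ne_zero (X_sub_C_ne_zero _) hq0
  rw [hfac, roots_mul hprod0, roots_X_sub_C]
  suffices hq : (X ^ 2 + C ((W.b₂ : ℚ_[2]) + e) * X +
      C ((e : ℚ_[2]) ^ 2 + (W.b₂ : ℚ_[2]) * e + 8 * (W.b₄ : ℚ_[2]))).roots = 0 by
    rw [hq, add_zero]
  refine Multiset.eq_zero_of_forall_notMem fun x hx ↦ hK ?_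
  rw [mem_roots hq0] at hx
  rw [onKilfordStratumAtTwo_iff_splits, hfac, splits_X_sub_C_mul_iff]
  exact Splits.of_natDegree_eq_two hq2 hx

end Dictionary

end Summit.BirchSwinnertonDyer.BirchSwinnertonDyer.Theorems.AlignedTransportAtTwoKilfordStratumHeightOne

end
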